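import Summits.HodgeConjecture.HodgeConjecture.Theorems.F0P3cStCharTSDeltaAtLevi          -- ★ p849601 (c₃) `exists_class_delta_eq_finTau_mul_finWeylRatio_qsForm`
import Summits.HodgeConjecture.HodgeConjecture.Theorems.F0P3cStCharTSOnStratumG           -- ★ p849509 `finsum_delta_mul_classOrbitalIntegral_eq_of_on`
import Summits.HodgeConjecture.HodgeConjecture.Theorems.F0P3cStCharTSDeepLeviPrefactor     -- ★ p849641 (c₅a) `finWeylRatio_mul_weightG_eq_weightH`
import HarnessLib

/-!
# F0 · P3c · line LH6 «StCharTS» — road (D) «DEEP-FL», brick (D-c)(γ) = (c₅b) «HLEVI OF CLOSED FORMS»: the Levi scalar identity `hlevi` of ★ `isLocalDeltaTransfer_of_levi`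
# follows from the two D3-ii closed forms and ONE pointwise identity of step functions `Φ_H(t_H) = τ_v(γ_H) · Φ_G(ι t_H)` on the oriented hyperbolic Levi torus

Cell `pub/hodgecm-mathlib`, crux H413 = `stmt-HodgeConjecture-24833` (lane `--supports … --as helper`), route HCCMUnconditional; seat LH6-p04 (g3) (lineage heir of the
road-(D) owner LH6-p04 (g2); road owner of record LH6-p03 (g0), ROAD-D status v5 `F0/P3b/LH6-p03/g0/ROAD-D.status.v5.txt` OPEN item (γ), «=» 2026-09-02T06:02:03Z; design
`F0/P3b/LH6-p04/g2/ROAD-D.c5-design.v1.txt`).  THEOREMS ONLY, sorry-free, ★-only imports; no definition ∕ instance ∕ notation ∕ named fact.  HONEST LABEL: HC_CM is proved only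
modulo the 7 printed citations (2 remaining: hLiu418 = stmt-HodgeConjecture-24832, h413 = stmt-HodgeConjecture-24833) until rung 0 closes; count-neutral plumbing of road (D)
— (S-X) `stub_StXIGSt` stays sorried until the (D-c) assembly lands.

THE MATHEMATICS ([Rogawski1990, §4.9 Lemma 4.9.2 and (4.9.4) p. 56: «`D_H Φ^H(γ_H) = τ(γ_H) D_G Φ(γ)` on the Levi torus»; §4.3 (4.3.1) p. 43; §12.7 L. 12.7.3 (proof) p. 195]).
The socket `hlevi` of ★ `F0P3cStCharTSTransferOfLevi.isLocalDeltaTransfer_of_levi` asks, at every `G`-regular diagonal-Levi `γ_H = (diag(d′₀, d′₁), u) ∈ H_v` hyperbolic at the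
non-split place `w` (`|d′₁|_w < |d′₀|_w`, `σ_w(d′₀,w)·d′₁,w = 1`), for `Φ([γ_H], f^H) = Σ_c Δ‴(γ_H, c) Φ(c, f)`.  §1: such a `γ_H` is ON the stratum (`|det h₂|_w = 1 < |d′₀|_w² =
|tr h₂|_w²`, ultrametric), so by ★ D3-iv-b (`finsum_delta_mul_classOrbitalIntegral_eq_of_on`) and ★ (c₃) (`exists_class_delta_eq_finTau_mul_finWeylRatio_qsForm`) the right side is
`τ_v(γ_H) · D_{G∕H,v}(γ_H) · Φ([e(ι_v γ_H)], f)` (`τ_v = finTau`, `D = finWeylRatio`, `e` the quasi-split frame).  §2: if the two canonical orbital integrals are known in the D3-ii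
closed forms — `Φ([e(t)], f) = W_G(t) · δ_B^{1∕2}(t)⁻¹ · Φ_G(t)` at `t = ι_v γ_H ∈ T₃` (hypothesis `hOG` BY SHAPE = the conclusion of ★ `F0P3cStCharTSShellOrbitalG.classOrbitalIntegral_mk_eq_twoCoset`
at the quasi-split frame and the diagonal `(d′₀, u, d′₁)`, its two-coset step function abstracted to `Φ_G`) and `Φ([γ_H], f^H) = δ_{B₂}^{1∕2}(t_H)⁻¹ · W_H(t_H) · Φ_H(t_H, u)` at
`t_H = h₂ ∈ T₂` (hypothesis `hOH` BY SHAPE = the conclusion of ★ `F0P3cStCharTSShellOrbitalH.classOrbitalIntegralH_eq_twoCoset_apply`, step function abstracted to `Φ_H`) — then,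
since `D_{G∕H,v}(γ_H) · W_G(t) · δ_B^{1∕2}(t)⁻¹ = δ_{B₂}^{1∕2}(t_H)⁻¹ · W_H(t_H)` (★ (c₅a) `finWeylRatio_mul_weightG_eq_weightH`, Lemma 4.9.2's modulus cancellation), `hlevi` is
EQUIVALENT to the scalar identity of step functions `Φ_H(t_H, u) = τ_v(γ_H) · Φ_G(t)` on that stratum (hypothesis `hc`; discharged per coset by ★ `F0P3cStCharTSDeltaCosetConst` +
★ `F0P3cStCharTSCosetSum` for the refined `f^H₀ = Σ_j c_j 𝟙_{K_H u_j K_H}` of ROAD-D v5 CHANGE 1).  This file proves «`hOG ∧ hOH ∧ hc ⇒ hlevi`» VERBATIM in the binder text of ★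
`isLocalDeltaTransfer_of_levi` at `T := finExplicitCollection L (qsForm L) μ hl hr v` (Δ‴).

* §1 `valued_det_lt_valued_trace_sq_of_hyperbolic` — hyperbolic diagonal Levi data ⇒ ON the stratum.
* §2 `finsum_delta_mul_eq_of_hyperbolic` — the right side of `hlevi` is `τ_v · D · Φ([e(ι_v γ_H)], f)`; **`hlevi_of_closed_forms`** — the head.

## References
* [Rogawski1990] J. D. Rogawski, *Automorphic Representations of Unitary Groups in Three Variables*, Ann. of Math. Stud. 123 (1990): §4.9 Lemma 4.9.2, (4.9.4) p. 56;
  §4.3 (4.3.1) p. 43; §12.7 Lemma 12.7.3 (proof) p. 195.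
* [vanDijk1972] G. van Dijk, *Computation of certain induced characters of p-adic groups*, Math. Ann. 199 (1972), Thm. p. 237.
-/

set_option autoImplicit false
-- the mandated namespace has the single-problem summit's repeated segment (`HodgeConjecture.HodgeConjecture`)
set_option linter.dupNamespace false

noncomputable section

open MeasureTheory Matrix NumberField IsDedekindDomain
open scoped NNReal MatrixGroups
open Literature.NumberTheory.Rogawski1990 Literature.NumberTheory.Automorphic Literature.NumberTheory.Automorphic.UnitaryGroup
open Literature.NumberTheory.GaloisRepresentations

namespace Summit.HodgeConjecture.HodgeConjecture.Cruxes.H413.F0P3cStCharTSHleviOfClosedForms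

variable (L : Type) [Field L] [NumberField L] [IsCMField L] (v : HeightOneSpectrum (𝓞 ↥(maximalRealSubfield L)))
  (w : PlacesOver L v) (hw : IsCMField.complexConj L • w.1 = w.1)

/-! ## §1 Hyperbolic diagonal Levi data put `γ_H` ON the stratum -/

/-- **Hyperbolic ⇒ ON.**  For `γ_H = (h₂, h₁) ∈ H_v` with `h₂ = diag(d′₀, d′₁)`, `|d′₁|_w < |d′₀|_w` and `σ_w(d′₀,w)·d′₁,w = 1`: `|det h₂|_w < |tr h₂|_w²`
(`|det h₂|_w = |d′₀|_w·|d′₁|_w = 1` as `|σ_w x|_w = |x|_w`; `|tr h₂|_w = |d′₀ + d′₁|_w = |d′₀|_w > 1`). [cite: Rogawski1990, §4.9 p. 56; §3.6 p. 31] -/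
theorem valued_det_lt_valued_trace_sq_of_hyperbolic
    (γH : ((cmDatum L 2 (Matrix.of fun i j : Fin 2 => if i.val + j.val + 1 = 2 then (1 : L) else 0)).Local v ×
      (cmDatum L 1 (Matrix.of fun i j : Fin 1 => if i.val + j.val + 1 = 1 then (1 : L) else 0)).Local v))
    {d' : Fin 2 → (LocalRing L v)ˣ} (hd' : glDiagonal 2 (LocalRing L v) d' = ((γH.1).val : GL (Fin 2) (LocalRing L v)))
    (hlt : Valued.v (((d' 1 : (LocalRing L v)ˣ) : LocalRing L v) w) < Valued.v (((d' 0 : (LocalRing L v)ˣ) : LocalRing L v) w))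
    (h01 : galAdicCompletionMap (L := L) (IsCMField.complexConj L) hw (((d' 0 : (LocalRing L v)ˣ) : LocalRing L v) w) * ((d' 1 : (LocalRing L v)ˣ) : LocalRing L v) w = 1) :
    Valued.v ((Pi.evalRingHom (fun w' : PlacesOver L v => w'.1.adicCompletion L) w) ((γH.1.val : GL (Fin 2) (LocalRing L v)) : Matrix (Fin 2) (Fin 2) (LocalRing L v)).det) <
      Valued.v ((Pi.evalRingHom (fun w' : PlacesOver L v => w'.1.adicCompletion L) w) ((γH.1.val : GL (Fin 2) (LocalRing L v)) : Matrix (Fin 2) (Fin 2) (LocalRing L v)).trace) ^ 2 := by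
  have hσv : ∀ x, Valued.v (galAdicCompletionMap (L := L) (IsCMField.complexConj L) hw x) = Valued.v x :=
    fun x => valued_galAdicCompletionMap (L := L) (IsCMField.complexConj L) hw x
  -- `h₂ = diag(d′)` as a matrix
  have hM := congrArg Units.val hd'
  rw [coe_glDiagonal] at hM
  -- hM : diagonal (fun i => ↑(d' i)) = ↑(γH.1.val)
  have hdet : (Pi.evalRingHom (fun w' : PlacesOver L v => w'.1.adicCompletion L) w) ((γH.1.val : GL (Fin 2) (LocalRing L v)) : Matrix (Fin 2) (Fin 2) (LocalRing L v)).det =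
      ((d' 0 : (LocalRing L v)ˣ) : LocalRing L v) w * ((d' 1 : (LocalRing L v)ˣ) : LocalRing L v) w := by
    rw [← hM, Matrix.det_diagonal, Fin.prod_univ_two, map_mul]
    rfl
  have htr : (Pi.evalRingHom (fun w' : PlacesOver L v => w'.1.adicCompletion L) w) ((γH.1.val : GL (Fin 2) (LocalRing L v)) : Matrix (Fin 2) (Fin 2) (LocalRing L v)).trace =
      ((d' 0 : (LocalRing L v)ˣ) : LocalRing L v) w + ((d' 1 : (LocalRing L v)ˣ) : LocalRing L v) w := by
    rw [← hM, Matrix.trace_fin_two, Matrix.diagonal_apply_eq, Matrix.diagonal_apply_eq, map_add]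
    rfl
  -- `|d′₀|·|d′₁| = 1`, `|d′₁| < 1 < |d′₀|`
  have h1 : Valued.v (((d' 0 : (LocalRing L v)ˣ) : LocalRing L v) w) * Valued.v (((d' 1 : (LocalRing L v)ˣ) : LocalRing L v) w) = 1 := by
    rw [← hσv (((d' 0 : (LocalRing L v)ˣ) : LocalRing L v) w), ← map_mul, h01, map_one]
  have h0 := (F0P3cStCharTSOnStratumG.lt_one_lt_of_mul_eq_one_of_lt Valued.v h1 hlt).2
  rw [hdet, htr, map_mul, h1, Valued.v.map_add_eq_of_lt_left hlt, sq]
  exact one_lt_mul'' h0 h0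

/-! ## §2 The right side of `hlevi`, and the head -/

open scoped Classical in
set_option maxHeartbeats 1600000 in  -- statement-level `whnf` on the CM carriers (same class as ★ `isLocalDeltaTransfer_of_levi`)
/-- **The right side of `hlevi` at a hyperbolic diagonal Levi `γ_H`** for `T = Δ‴` (★ `finExplicitCollection` at the quasi-split form): it collapses to the single Δ‴-matched class
`[e(ι_v γ_H)]` (`e` the quasi-split frame ★ `cmDatumLocalCongr L v 1 _ (formCongr_one_qsForm L v)`), with `Δ‴ = τ_v · D_{G∕H,v}`:
`Σ_c Δ‴(γ_H, out c) Φ(c, f) = finTau L v γ_H μ · finWeylRatio L v γ_H · Φ([e(ι_v γ_H)], f)` (§1 + ★ D3-iv-b + ★ (c₃)). [cite: Rogawski1990, §4.9 p. 55–56; §4.3 (4.3.1) p. 43] -/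
theorem finsum_delta_mul_eq_of_hyperbolic
    [∀ γ : (cmDatum L 3 (qsForm L)).Local v, MeasurableSpace ((cmDatum L 3 (qsForm L)).Local v ⧸ Subgroup.centralizer ({γ} : Set ((cmDatum L 3 (qsForm L)).Local v)))]
    (μ : HeckeCharacter L)
    (hl : ∀ (v : HeightOneSpectrum (𝓞 ↥(maximalRealSubfield L)))
      (a : (UnitaryGroup.cmDatum L 2 (Matrix.of fun i j : Fin 2 => if i.val + j.val + 1 = 2 then (1 : L) else 0)).Local v ×
      (UnitaryGroup.cmDatum L 1 (Matrix.of fun i j : Fin 1 => if i.val + j.val + 1 = 1 then (1 : L) else 0)).Local v)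
      (b : (UnitaryGroup.cmDatum L 3 (qsForm L)).Local v)
      (x : (UnitaryGroup.cmDatum L 2 (Matrix.of fun i j : Fin 2 => if i.val + j.val + 1 = 2 then (1 : L) else 0)).Local v ×
      (UnitaryGroup.cmDatum L 1 (Matrix.of fun i j : Fin 1 => if i.val + j.val + 1 = 1 then (1 : L) else 0)).Local v),
      finExplicitDelta L v (qsForm L) (x * a * x⁻¹) μ b = finExplicitDelta L v (qsForm L) a μ b)
    (hr : ∀ (v : HeightOneSpectrum (𝓞 ↥(maximalRealSubfield L)))
      (a : (UnitaryGroup.cmDatum L 2 (Matrix.of fun i j : Fin 2 => if i.val + j.val + 1 = 2 then (1 : L) else 0)).Local v ×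
      (UnitaryGroup.cmDatum L 1 (Matrix.of fun i j : Fin 1 => if i.val + j.val + 1 = 1 then (1 : L) else 0)).Local v)
      (b y : (UnitaryGroup.cmDatum L 3 (qsForm L)).Local v),
      finExplicitDelta L v (qsForm L) a μ (y * b * y⁻¹) = finExplicitDelta L v (qsForm L) a μ b)
    (mG : OrbitalMeasureFamily ((cmDatum L 3 (qsForm L)).Local v)) (f : (cmDatum L 3 (qsForm L)).Local v → ℂ)
    (γH : ((cmDatum L 2 (Matrix.of fun i j : Fin 2 => if i.val + j.val + 1 = 2 then (1 : L) else 0)).Local v ×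
      (cmDatum L 1 (Matrix.of fun i j : Fin 1 => if i.val + j.val + 1 = 1 then (1 : L) else 0)).Local v))
    {d' : Fin 2 → (LocalRing L v)ˣ} (hd' : glDiagonal 2 (LocalRing L v) d' = ((γH.1).val : GL (Fin 2) (LocalRing L v))) (hreg : IsLocalGRegular L v γH)
    (hlt : Valued.v (((d' 1 : (LocalRing L v)ˣ) : LocalRing L v) w) < Valued.v (((d' 0 : (LocalRing L v)ˣ) : LocalRing L v) w))
    (h01 : galAdicCompletionMap (L := L) (IsCMField.complexConj L) hw (((d' 0 : (LocalRing L v)ˣ) : LocalRing L v) w) * ((d' 1 : (LocalRing L v)ˣ) : LocalRing L v) w = 1) :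
    ∑ᶠ c : ConjClasses ((cmDatum L 3 (qsForm L)).Local v), (finExplicitCollection L (qsForm L) μ hl hr v).Δ γH (Quotient.out c) * classOrbitalIntegral mG f c =
      finTau L v γH μ * (finWeylRatio L v γH : ℂ) *
        classOrbitalIntegral mG f (ConjClasses.mk (cmDatumLocalCongr L v (1 : GL (Fin 3) (UnitaryGroup.LocalRing L v)) isUnit_one (F0P3cStCharTSDeltaAtLevi.formCongr_one_qsForm L v)
          (endoEmbLocal L v γH))) := by
  obtain ⟨c₀, hc₀, hΔ, hΔ0⟩ := F0P3cStCharTSDeltaAtLevi.exists_class_delta_eq_finTau_mul_finWeylRatio_qsForm L w hw μ hl hr γH hd' hreg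
  rw [F0P3cStCharTSOnStratumG.finsum_delta_mul_classOrbitalIntegral_eq_of_on L v w hw (finExplicitCollection L (qsForm L) μ hl hr v) mG f γH
    (valued_det_lt_valued_trace_sq_of_hyperbolic L v w hw γH hd' hlt h01) c₀ hΔ0, hΔ, hc₀]

open scoped Classical in
set_option maxHeartbeats 3200000 in  -- statement-level `whnf` on the CM carriers and the modulus tokens of ★ D3-ii-G ∕ D3-ii-H ∕ (c₅a)
set_option synthInstance.maxHeartbeats 400000 in
/-- **(D-c)(γ) = (c₅b) «HLEVI OF CLOSED FORMS».**  Binders: the `hlevi` prefix of ★ `isLocalDeltaTransfer_of_levi` at `T := finExplicitCollection L (qsForm L) μ hl hr v` (Δ‴), two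
step functions `Φ_G : T₃ → ℂ`, `Φ_H : T₂ × U(Φ₁)_v → ℂ`, and three hypotheses BY SHAPE, each quantified over the hyperbolic `G`-regular diagonal-Levi data `(γ_H, d′)` of `hlevi`
together with the torus points `t = ι_v γ_H ∈ T₃` (diagonal `(d′₀, γ₂, d′₁)`, ★ `endoEmbLocal_eq_glDiagonal_of_fst_eq`) and `t_H = h₂ ∈ T₂` and the three Levi units (★
`isUnit_levi_of_isLocalGRegular_of_nonsplit`) this theorem SUPPLIES: `hOG` — the canonical `G`-orbital integral at `[e(t)]` in the token shape of ★
`classOrbitalIntegral_mk_eq_twoCoset` (`= W_G · δ_B^{1∕2}(t)⁻¹ · Φ_G(t)`); `hOH` — the canonical `H`-orbital integral at `[(t_H, u)]` in the token shape of ★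
`classOrbitalIntegralH_eq_twoCoset_apply` (`= δ_{B₂}^{1∕2}(t_H)⁻¹ · W_H · Φ_H(t_H, u)`); `hc` — the scalar identity `Φ_H(t_H, u) = finTau L v γ_H μ · Φ_G(t)`.  CONCLUSION: the
`hlevi` clause VERBATIM.  (§2 `finsum_delta_mul_eq_of_hyperbolic` + ★ (c₅a) `finWeylRatio_mul_weightG_eq_weightH`.) [cite: Rogawski1990, §4.9 Lemma 4.9.2, (4.9.4) p. 56; §4.3 (4.3.1) p. 43;
§12.7 Lemma 12.7.3 (proof) p. 195] [cite: vanDijk1972, Thm. p. 237] -/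
theorem hlevi_of_closed_forms
    [∀ γ : (cmDatum L 3 (qsForm L)).Local v, MeasurableSpace ((cmDatum L 3 (qsForm L)).Local v ⧸ Subgroup.centralizer ({γ} : Set ((cmDatum L 3 (qsForm L)).Local v)))]
    [∀ aH : ((cmDatum L 2 (Matrix.of fun i j : Fin 2 => if i.val + j.val + 1 = 2 then (1 : L) else 0)).Local v × (cmDatum L 1 (Matrix.of fun i j : Fin 1 => if i.val + j.val + 1 = 1 then (1 : L) else 0)).Local v),
      MeasurableSpace (((cmDatum L 2 (Matrix.of fun i j : Fin 2 => if i.val + j.val + 1 = 2 then (1 : L) else 0)).Local v × (cmDatum L 1 (Matrix.of fun i j : Fin 1 => if i.val + j.val + 1 = 1 then (1 : L) else 0)).Local v) ⧸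
        Subgroup.centralizer ({aH} : Set ((cmDatum L 2 (Matrix.of fun i j : Fin 2 => if i.val + j.val + 1 = 2 then (1 : L) else 0)).Local v × (cmDatum L 1 (Matrix.of fun i j : Fin 1 => if i.val + j.val + 1 = 1 then (1 : L) else 0)).Local v)))]
    (μ : HeckeCharacter L)
    (hl : ∀ (v : HeightOneSpectrum (𝓞 ↥(maximalRealSubfield L)))
      (a : (UnitaryGroup.cmDatum L 2 (Matrix.of fun i j : Fin 2 => if i.val + j.val + 1 = 2 then (1 : L) else 0)).Local v ×
      (UnitaryGroup.cmDatum L 1 (Matrix.of fun i j : Fin 1 => if i.val + j.val + 1 = 1 then (1 : L) else 0)).Local v)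
      (b : (UnitaryGroup.cmDatum L 3 (qsForm L)).Local v)
      (x : (UnitaryGroup.cmDatum L 2 (Matrix.of fun i j : Fin 2 => if i.val + j.val + 1 = 2 then (1 : L) else 0)).Local v ×
      (UnitaryGroup.cmDatum L 1 (Matrix.of fun i j : Fin 1 => if i.val + j.val + 1 = 1 then (1 : L) else 0)).Local v),
      finExplicitDelta L v (qsForm L) (x * a * x⁻¹) μ b = finExplicitDelta L v (qsForm L) a μ b)
    (hr : ∀ (v : HeightOneSpectrum (𝓞 ↥(maximalRealSubfield L)))
      (a : (UnitaryGroup.cmDatum L 2 (Matrix.of fun i j : Fin 2 => if i.val + j.val + 1 = 2 then (1 : L) else 0)).Local v ×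
      (UnitaryGroup.cmDatum L 1 (Matrix.of fun i j : Fin 1 => if i.val + j.val + 1 = 1 then (1 : L) else 0)).Local v)
      (b y : (UnitaryGroup.cmDatum L 3 (qsForm L)).Local v),
      finExplicitDelta L v (qsForm L) a μ (y * b * y⁻¹) = finExplicitDelta L v (qsForm L) a μ b)
    (mH : OrbitalMeasureFamily ((cmDatum L 2 (Matrix.of fun i j : Fin 2 => if i.val + j.val + 1 = 2 then (1 : L) else 0)).Local v ×
      (cmDatum L 1 (Matrix.of fun i j : Fin 1 => if i.val + j.val + 1 = 1 then (1 : L) else 0)).Local v))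
    (mG : OrbitalMeasureFamily ((cmDatum L 3 (qsForm L)).Local v))
    (fH : ((cmDatum L 2 (Matrix.of fun i j : Fin 2 => if i.val + j.val + 1 = 2 then (1 : L) else 0)).Local v ×
      (cmDatum L 1 (Matrix.of fun i j : Fin 1 => if i.val + j.val + 1 = 1 then (1 : L) else 0)).Local v) → ℂ) (f : (cmDatum L 3 (qsForm L)).Local v → ℂ)
    (ΦG : ↥(cmBorelTriple L 3 v).M → ℂ)
    (ΦH : ↥(cmBorelTriple L 2 v).M × (cmDatum L 1 (Matrix.of fun i j : Fin 1 => if i.val + j.val + 1 = 1 then (1 : L) else 0)).Local v → ℂ)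
    -- (c₄)-G BY SHAPE: the conclusion of ★ `classOrbitalIntegral_mk_eq_twoCoset` at the quasi-split frame, `t = ι_v γ_H`, `d = (d′₀, γ₂, d′₁)`
    (hOG : ∀ (γH : ((cmDatum L 2 (Matrix.of fun i j : Fin 2 => if i.val + j.val + 1 = 2 then (1 : L) else 0)).Local v × (cmDatum L 1 (Matrix.of fun i j : Fin 1 => if i.val + j.val + 1 = 1 then (1 : L) else 0)).Local v))
      (d' : Fin 2 → (LocalRing L v)ˣ), glDiagonal 2 (LocalRing L v) d' = ((γH.1).val : GL (Fin 2) (LocalRing L v)) → IsLocalGRegular L v γH →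
      Valued.v (((d' 1 : (LocalRing L v)ˣ) : LocalRing L v) w) < Valued.v (((d' 0 : (LocalRing L v)ˣ) : LocalRing L v) w) →
      galAdicCompletionMap (L := L) (IsCMField.complexConj L) hw (((d' 0 : (LocalRing L v)ˣ) : LocalRing L v) w) * ((d' 1 : (LocalRing L v)ˣ) : LocalRing L v) w = 1 →
      ∀ (t : ↥(cmBorelTriple L 3 v).M), (t : ↥(unitaryGroupOfForm (conjLocal L (IsCMField.complexConj L) v) (cmLocalForm L 3 v))) = endoEmbLocal L v γH →
      ∀ (hd : glDiagonal 3 (UnitaryGroup.LocalRing L v) ![d' 0, (isUnit_finGammaTwo L v γH).unit, d' 1] =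
          ((t : ↥(unitaryGroupOfForm (conjLocal L (IsCMField.complexConj L) v) (cmLocalForm L 3 v))) : GL (Fin 3) (UnitaryGroup.LocalRing L v)))
        (ha : IsUnit ((((![d' 0, (isUnit_finGammaTwo L v γH).unit, d' 1] 0)⁻¹ * ![d' 0, (isUnit_finGammaTwo L v γH).unit, d' 1] 1 : (UnitaryGroup.LocalRing L v)ˣ) : (UnitaryGroup.LocalRing L v)) - 1))
        (hb' : IsUnit ((((![d' 0, (isUnit_finGammaTwo L v γH).unit, d' 1] 0)⁻¹ * ![d' 0, (isUnit_finGammaTwo L v γH).unit, d' 1] 2 : (UnitaryGroup.LocalRing L v)ˣ) : (UnitaryGroup.LocalRing L v)) - 1)),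
      haveI := locallyCompactSpace_cmBorelU L 3 v
      classOrbitalIntegral mG f
          (ConjClasses.mk (cmDatumLocalCongr L v (1 : GL (Fin 3) (UnitaryGroup.LocalRing L v)) isUnit_one (F0P3cStCharTSDeltaAtLevi.formCongr_one_qsForm L v)
            (t : ↥(unitaryGroupOfForm (conjLocal L (IsCMField.complexConj L) v) (cmLocalForm L 3 v))))) =
        (((letI : MeasurableSpace (UnitaryGroup.LocalRing L v) := borel _; haveI : BorelSpace (UnitaryGroup.LocalRing L v) := ⟨rfl⟩
            haveI : SecondCountableTopology (UnitaryGroup.LocalRing L v) := secondCountableTopology_localRing (E := L) v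
            ((distribHaarChar (UnitaryGroup.LocalRing L v) ha.unit)⁻¹ *
              (HeisRing.skewModulus (conjLocal L (IsCMField.complexConj L) v) (continuous_conjLocal L (IsCMField.complexConj L) v) hb'.unit
                (HeisRing.map_unit_torusCentralScalar_sub_one (conjLocal L (IsCMField.complexConj L) v) (cmLocalForm_eq_over L 3 v) t hd hb'))⁻¹ :
                  ℝ≥0)) : ℝ) : ℂ) *
          ((rootDeltaChar (cmBorelTriple L 3 v).P
              ⟨(t : ↥(unitaryGroupOfForm (conjLocal L (IsCMField.complexConj L) v) (cmLocalForm L 3 v))), (cmBorelTriple L 3 v).M_le t.2⟩ : ℂˣ) : ℂ)⁻¹ *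
          ΦG t)
    -- (c₄)-H BY SHAPE: the conclusion of ★ `classOrbitalIntegralH_eq_twoCoset_apply` at `t_H = h₂`, `u = γ_H.2`, `d = d′`
    (hOH : ∀ (γH : ((cmDatum L 2 (Matrix.of fun i j : Fin 2 => if i.val + j.val + 1 = 2 then (1 : L) else 0)).Local v × (cmDatum L 1 (Matrix.of fun i j : Fin 1 => if i.val + j.val + 1 = 1 then (1 : L) else 0)).Local v))
      (d' : Fin 2 → (LocalRing L v)ˣ), glDiagonal 2 (LocalRing L v) d' = ((γH.1).val : GL (Fin 2) (LocalRing L v)) → IsLocalGRegular L v γH →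
      Valued.v (((d' 1 : (LocalRing L v)ˣ) : LocalRing L v) w) < Valued.v (((d' 0 : (LocalRing L v)ˣ) : LocalRing L v) w) →
      galAdicCompletionMap (L := L) (IsCMField.complexConj L) hw (((d' 0 : (LocalRing L v)ˣ) : LocalRing L v) w) * ((d' 1 : (LocalRing L v)ˣ) : LocalRing L v) w = 1 →
      ∀ (tH : ↥(cmBorelTriple L 2 v).M), (tH : ↥(unitaryGroupOfForm (conjLocal L (IsCMField.complexConj L) v) (cmLocalForm L 2 v))) = γH.1 →
      ∀ (hdH : glDiagonal 2 (LocalRing L v) d' = ((tH : ↥(unitaryGroupOfForm (conjLocal L (IsCMField.complexConj L) v) (cmLocalForm L 2 v))) : GL (Fin 2) (LocalRing L v)))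
        (hb : IsUnit ((((d' 0)⁻¹ * d' 1 : (LocalRing L v)ˣ) : LocalRing L v) - 1)),
      haveI := locallyCompactSpace_cmBorelU L 2 v
      classOrbitalIntegral mH fH (ConjClasses.mk (((tH : ↥(unitaryGroupOfForm (conjLocal L (IsCMField.complexConj L) v) (cmLocalForm L 2 v))) :
          ((cmDatum L 2 (Matrix.of fun i j : Fin 2 => if i.val + j.val + 1 = 2 then (1 : L) else 0)).Local v)), γH.2)) =
        ((rootDeltaChar (cmBorelTriple L 2 v).P ⟨(tH : ↥(unitaryGroupOfForm (conjLocal L (IsCMField.complexConj L) v) (cmLocalForm L 2 v))), (cmBorelTriple L 2 v).M_le tH.2⟩ : ℂˣ) : ℂ)⁻¹ *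
          (((letI : MeasurableSpace (LocalRing L v) := borel _; haveI : BorelSpace (LocalRing L v) := ⟨rfl⟩
            haveI : SecondCountableTopology (LocalRing L v) := secondCountableTopology_localRing (E := L) v
            ((HeisRing.skewModulus (conjLocal L (IsCMField.complexConj L) v) (continuous_conjLocal L (IsCMField.complexConj L) v) hb.unit
              (LineRing.map_unit_torusScalar_sub_one_two (conjLocal L (IsCMField.complexConj L) v) (cmLocalForm_eq_over L 2 v)
                (⟨(tH : ↥(unitaryGroupOfForm (conjLocal L (IsCMField.complexConj L) v) (cmLocalForm L 2 v))), tH.2⟩ :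
                  ↥(torusU (conjLocal L (IsCMField.complexConj L) v) (cmLocalForm L 2 v))) hdH hb))⁻¹ : ℝ≥0)) : ℝ) : ℂ) *
          ΦH (tH, γH.2))
    -- (c₅) BY SHAPE: the scalar identity of the step functions on the oriented hyperbolic Levi torus
    (hc : ∀ (γH : ((cmDatum L 2 (Matrix.of fun i j : Fin 2 => if i.val + j.val + 1 = 2 then (1 : L) else 0)).Local v × (cmDatum L 1 (Matrix.of fun i j : Fin 1 => if i.val + j.val + 1 = 1 then (1 : L) else 0)).Local v))
      (d' : Fin 2 → (LocalRing L v)ˣ), glDiagonal 2 (LocalRing L v) d' = ((γH.1).val : GL (Fin 2) (LocalRing L v)) → IsLocalGRegular L v γH →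
      Valued.v (((d' 1 : (LocalRing L v)ˣ) : LocalRing L v) w) < Valued.v (((d' 0 : (LocalRing L v)ˣ) : LocalRing L v) w) →
      galAdicCompletionMap (L := L) (IsCMField.complexConj L) hw (((d' 0 : (LocalRing L v)ˣ) : LocalRing L v) w) * ((d' 1 : (LocalRing L v)ˣ) : LocalRing L v) w = 1 →
      ∀ (tH : ↥(cmBorelTriple L 2 v).M), (tH : ↥(unitaryGroupOfForm (conjLocal L (IsCMField.complexConj L) v) (cmLocalForm L 2 v))) = γH.1 →
      ∀ (t : ↥(cmBorelTriple L 3 v).M), (t : ↥(unitaryGroupOfForm (conjLocal L (IsCMField.complexConj L) v) (cmLocalForm L 3 v))) = endoEmbLocal L v γH →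
      ΦH (tH, γH.2) = finTau L v γH μ * ΦG t)
    -- the `hlevi` binders
    (γH : ((cmDatum L 2 (Matrix.of fun i j : Fin 2 => if i.val + j.val + 1 = 2 then (1 : L) else 0)).Local v × (cmDatum L 1 (Matrix.of fun i j : Fin 1 => if i.val + j.val + 1 = 1 then (1 : L) else 0)).Local v))
    (d' : Fin 2 → (LocalRing L v)ˣ) (hd' : glDiagonal 2 (LocalRing L v) d' = ((γH.1).val : GL (Fin 2) (LocalRing L v))) (hreg : IsLocalGRegular L v γH)
    (hlt : Valued.v (((d' 1 : (LocalRing L v)ˣ) : LocalRing L v) w) < Valued.v (((d' 0 : (LocalRing L v)ˣ) : LocalRing L v) w))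
    (h01 : galAdicCompletionMap (L := L) (IsCMField.complexConj L) hw (((d' 0 : (LocalRing L v)ˣ) : LocalRing L v) w) * ((d' 1 : (LocalRing L v)ˣ) : LocalRing L v) w = 1) :
    classOrbitalIntegral mH fH (ConjClasses.mk γH) =
      ∑ᶠ c : ConjClasses ((cmDatum L 3 (qsForm L)).Local v), (finExplicitCollection L (qsForm L) μ hl hr v).Δ γH (Quotient.out c) * classOrbitalIntegral mG f c := by
  haveI := locallyCompactSpace_cmBorelU L 2 v
  haveI := locallyCompactSpace_cmBorelU L 3 v
  -- the torus points `t_H = h₂ ∈ T₂` and `t = ι_v γ_H ∈ T₃`, the diagonal of `t`, the three Levi units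
  have hι := endoEmbLocal_eq_glDiagonal_of_fst_eq L v γH hd'
  obtain ⟨hua, hub, h12⟩ := isUnit_levi_of_isLocalGRegular_of_nonsplit L w hw hd' hreg
  set tH : ↥(cmBorelTriple L 2 v).M := ⟨(γH.1 : ↥(unitaryGroupOfForm (conjLocal L (IsCMField.complexConj L) v) (cmLocalForm L 2 v))),
    F0P3bInducedCharTransferLeviDictionary.fst_mem_torusU_of_glDiagonal_eq L v hd'⟩ with htHdef
  have htH : (tH : ↥(unitaryGroupOfForm (conjLocal L (IsCMField.complexConj L) v) (cmLocalForm L 2 v))) = γH.1 := rfl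
  have hdH : glDiagonal 2 (LocalRing L v) d' = ((tH : ↥(unitaryGroupOfForm (conjLocal L (IsCMField.complexConj L) v) (cmLocalForm L 2 v))) : GL (Fin 2) (LocalRing L v)) := hd'
  set t : ↥(cmBorelTriple L 3 v).M := ⟨(endoEmbLocal L v γH : ↥(unitaryGroupOfForm (conjLocal L (IsCMField.complexConj L) v) (cmLocalForm L 3 v))),
    endoEmbLocal_mem_torusU_of_endoEmbLocal_eq L v γH hι⟩ with htdef
  have ht : (t : ↥(unitaryGroupOfForm (conjLocal L (IsCMField.complexConj L) v) (cmLocalForm L 3 v))) = endoEmbLocal L v γH := rfl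
  have hd : glDiagonal 3 (UnitaryGroup.LocalRing L v) ![d' 0, (isUnit_finGammaTwo L v γH).unit, d' 1] =
      ((t : ↥(unitaryGroupOfForm (conjLocal L (IsCMField.complexConj L) v) (cmLocalForm L 3 v))) : GL (Fin 3) (UnitaryGroup.LocalRing L v)) := hι.symm
  have ha : IsUnit ((((![d' 0, (isUnit_finGammaTwo L v γH).unit, d' 1] 0)⁻¹ * ![d' 0, (isUnit_finGammaTwo L v γH).unit, d' 1] 1 : (UnitaryGroup.LocalRing L v)ˣ) : (UnitaryGroup.LocalRing L v)) - 1) := hua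
  have hb' : IsUnit ((((![d' 0, (isUnit_finGammaTwo L v γH).unit, d' 1] 0)⁻¹ * ![d' 0, (isUnit_finGammaTwo L v γH).unit, d' 1] 2 : (UnitaryGroup.LocalRing L v)ˣ) : (UnitaryGroup.LocalRing L v)) - 1) := hub
  -- the three shape hypotheses at this point, and (c₅a)
  have hG := hOG γH d' hd' hreg hlt h01 t ht hd ha hb'
  have hH := hOH γH d' hd' hreg hlt h01 tH htH hdH hub
  have hcc := hc γH d' hd' hreg hlt h01 tH htH t ht
  have hW := F0P3cStCharTSDeepLeviPrefactor.finWeylRatio_mul_weightG_eq_weightH L v γH hd' tH htH hdH t ht hd ha hb' hub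
  -- name the scalars
  set δ₂ : ℂ := ((rootDeltaChar (cmBorelTriple L 2 v).P
        ⟨(tH : ↥(unitaryGroupOfForm (conjLocal L (IsCMField.complexConj L) v) (cmLocalForm L 2 v))), (cmBorelTriple L 2 v).M_le tH.2⟩ : ℂˣ) : ℂ) with hδ₂
  set δ₃ : ℂ := ((rootDeltaChar (cmBorelTriple L 3 v).P
        ⟨(t : ↥(unitaryGroupOfForm (conjLocal L (IsCMField.complexConj L) v) (cmLocalForm L 3 v))), (cmBorelTriple L 3 v).M_le t.2⟩ : ℂˣ) : ℂ) with hδ₃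
  set WG : ℂ := (((letI : MeasurableSpace (UnitaryGroup.LocalRing L v) := borel _; haveI : BorelSpace (UnitaryGroup.LocalRing L v) := ⟨rfl⟩
            haveI : SecondCountableTopology (UnitaryGroup.LocalRing L v) := secondCountableTopology_localRing (E := L) v
            ((distribHaarChar (UnitaryGroup.LocalRing L v) ha.unit)⁻¹ *
              (HeisRing.skewModulus (conjLocal L (IsCMField.complexConj L) v) (continuous_conjLocal L (IsCMField.complexConj L) v) hb'.unit
                (HeisRing.map_unit_torusCentralScalar_sub_one (conjLocal L (IsCMField.complexConj L) v) (cmLocalForm_eq_over L 3 v) t hd hb'))⁻¹ :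
                  ℝ≥0)) : ℝ) : ℂ) with hWG
  set WH : ℂ := (((letI : MeasurableSpace (UnitaryGroup.LocalRing L v) := borel _; haveI : BorelSpace (UnitaryGroup.LocalRing L v) := ⟨rfl⟩
            haveI : SecondCountableTopology (UnitaryGroup.LocalRing L v) := secondCountableTopology_localRing (E := L) v
            ((HeisRing.skewModulus (conjLocal L (IsCMField.complexConj L) v) (continuous_conjLocal L (IsCMField.complexConj L) v) hub.unit
              (LineRing.map_unit_torusScalar_sub_one_two (conjLocal L (IsCMField.complexConj L) v) (cmLocalForm_eq_over L 2 v) tH hdH hub))⁻¹ : ℝ≥0)) : ℝ) : ℂ) with hWH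
  -- read the four facts in the named scalars
  have hG' : classOrbitalIntegral mG f
      (ConjClasses.mk (cmDatumLocalCongr L v (1 : GL (Fin 3) (UnitaryGroup.LocalRing L v)) isUnit_one (F0P3cStCharTSDeltaAtLevi.formCongr_one_qsForm L v)
        (endoEmbLocal L v γH))) = WG * δ₃⁻¹ * ΦG t := hG
  have hH' : classOrbitalIntegral mH fH (ConjClasses.mk γH) = δ₂⁻¹ * WH * ΦH (tH, γH.2) := hH
  have hW' : (finWeylRatio L v γH : ℂ) * WG * δ₃⁻¹ = δ₂⁻¹ * WH := hW
  -- assemble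
  rw [finsum_delta_mul_eq_of_hyperbolic L v w hw μ hl hr mG f γH hd' hreg hlt h01, hG', hH', hcc]
  calc δ₂⁻¹ * WH * (finTau L v γH μ * ΦG t) = finTau L v γH μ * (δ₂⁻¹ * WH) * ΦG t := by ring
    _ = finTau L v γH μ * ((finWeylRatio L v γH : ℂ) * WG * δ₃⁻¹) * ΦG t := by rw [hW']
    _ = finTau L v γH μ * (finWeylRatio L v γH : ℂ) * (WG * δ₃⁻¹ * ΦG t) := by ring

end Summit.HodgeConjecture.HodgeConjecture.Cruxes.H413.F0P3cStCharTSHleviOfClosedForms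

end
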